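import Mathlib.Data.Finset.Card
import Mathlib.Data.Finset.Powerset
import Mathlib.Data.Finset.Image
import Mathlib.Order.Disjoint
import HarnessLib

/-!
# The staircase lemma (bottom faces inject upward into top faces, inside any up-set)

Support file (`--supports stmt-CriticalPhenomena-4575`, closed), prover `prim-cplus-coupling` (gen 45).  No definitions, no notations, no named facts,
no sorries; standard axioms.  Memo `prim-cplus-coupling/A5-COUPLING-gen45.md` §3.6.

SETTING.  A finite edge set `E`; a finite STAIRCASE FAMILY `M` of pairs `(a, b)` of subsets of `E`: the first components and the second components are
oppositely nested (`a ⊆ a' ∧ b' ⊆ b` or the other way round, for any two pairs) and every first component is disjoint from every second component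
(on a bundle: `a` = the last `x` edges of one thread, `b` = the last `y` edges of another thread, `(x, y)` running through the minimal elements of an
up-set of thresholds).  For a pair `μ = (a, b)` the BOTTOM FACE is `{ω : ω ∩ (a ∪ b) = ∅}` and the TOP FACE is `{ω : a ∪ b ⊆ ω}`.
THEOREM (`Coefficientwise.card_staircase_bottom_le_top`): for every up-closed event `𝒱` on `2^E`, the number of `𝒱`-colourings lying in SOME bottom face of
`M` is at most the number of `𝒱`-colourings lying in SOME top face of `M`.  (For one pair this is the bijection `ω ↦ ω ∪ a ∪ b`; the content is the union
over an antichain of thresholds.)  Proof: induction on `#E`, splitting the cube along one coordinate `c` that lies in no second component (or, symmetrically,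
in no first component — one of the two always exists by the disjointness): the slice `c ∈ ω` carries sources only through pairs with `c ∉ a`, which are
settled inside the slice; the slice `c ∉ ω` is the same problem on `E ∖ c` with `a ↦ a ∖ c`, and each of its targets either is a target already (certified by a
pair with `c ∉ a`) or becomes one after inserting `c`; the three groups of targets are disjoint.
USE (memo §3.6): on a bundle with two mixed threads both starting red, the type-1 bad colourings whose pair of trailing blue runs lies in the up-set
`{(x, y) : X₀ ∪ J_x ∪ J'_y ∈ 𝐃}` are in the bottom faces of its minimal elements, and every point of the corresponding top faces (inside the up-set
`𝒱 ∩ {both start red} ∩ {X⁻ ∈ 𝐀}`) is an `L₁`-point — the counting engine for the 'RR' part of the S-statement / of LP1 on 3-thread bundles.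
-/

namespace Summit.CriticalPhenomena.PercolationContinuityZ3.Theorems

open Finset

namespace Coefficientwise

variable {ι : Type*}

open Classical in
/-- **Staircase lemma, one coordinate step.**  If the conclusion holds on every proper sub-ground-set (hypothesis `IH`, for all staircase families and
all up-closed events there), and `c ∈ E` lies in no second component of `M`, then the conclusion holds on `E`.
[cite: KozmaNitzan2024, Questions 8–9 (§5.5 p. 36) (context); Harris 1960] -/
theorem card_staircase_step [DecidableEq ι] (E : Finset ι)
    (IH : ∀ E' : Finset ι, E'.card < E.card → ∀ M' : Finset (Finset ι × Finset ι),
      (∀ μ ∈ M', μ.1 ⊆ E' ∧ μ.2 ⊆ E') →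
      (∀ μ ∈ M', ∀ ν ∈ M', (μ.1 ⊆ ν.1 ∧ ν.2 ⊆ μ.2) ∨ (ν.1 ⊆ μ.1 ∧ μ.2 ⊆ ν.2)) →
      (∀ μ ∈ M', ∀ ν ∈ M', Disjoint μ.1 ν.2) →
      ∀ 𝒱' : Finset ι → Prop, (∀ ⦃s t : Finset ι⦄, s ⊆ t → 𝒱' s → 𝒱' t) →
        #((E'.powerset).filter fun ω => 𝒱' ω ∧ ∃ μ ∈ M', Disjoint ω (μ.1 ∪ μ.2)) ≤
          #((E'.powerset).filter fun ω => 𝒱' ω ∧ ∃ μ ∈ M', μ.1 ∪ μ.2 ⊆ ω))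
    (M : Finset (Finset ι × Finset ι))
    (hME : ∀ μ ∈ M, μ.1 ⊆ E ∧ μ.2 ⊆ E)
    (hst : ∀ μ ∈ M, ∀ ν ∈ M, (μ.1 ⊆ ν.1 ∧ ν.2 ⊆ μ.2) ∨ (ν.1 ⊆ μ.1 ∧ μ.2 ⊆ ν.2))
    (hdj : ∀ μ ∈ M, ∀ ν ∈ M, Disjoint μ.1 ν.2)
    (𝒱 : Finset ι → Prop) (hV : ∀ ⦃s t : Finset ι⦄, s ⊆ t → 𝒱 s → 𝒱 t)
    (c : ι) (hcE : c ∈ E) (hc2 : ∀ μ ∈ M, c ∉ μ.2) :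
    #((E.powerset).filter fun ω => 𝒱 ω ∧ ∃ μ ∈ M, Disjoint ω (μ.1 ∪ μ.2)) ≤
      #((E.powerset).filter fun ω => 𝒱 ω ∧ ∃ μ ∈ M, μ.1 ∪ μ.2 ⊆ ω) := by
  -- notation
  set E' : Finset ι := E.erase c with hE'
  have hE'card : E'.card < E.card := by
    rw [hE']; exact Finset.card_erase_lt_of_mem hcE
  set S : Finset (Finset ι) := (E.powerset).filter fun ω => 𝒱 ω ∧ ∃ μ ∈ M, Disjoint ω (μ.1 ∪ μ.2) with hS
  set T : Finset (Finset ι) := (E.powerset).filter fun ω => 𝒱 ω ∧ ∃ μ ∈ M, μ.1 ∪ μ.2 ⊆ ω with hT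
  -- the erased family M' and the sub-family M₀ of pairs whose first component avoids c
  set M' : Finset (Finset ι × Finset ι) := M.image fun μ => (μ.1.erase c, μ.2) with hM'
  set M₀ : Finset (Finset ι × Finset ι) := M.filter fun μ => c ∉ μ.1 with hM₀
  set 𝒱₁ : Finset ι → Prop := fun ω => 𝒱 (insert c ω) with h𝒱₁
  have hV₁ : ∀ ⦃s t : Finset ι⦄, s ⊆ t → 𝒱₁ s → 𝒱₁ t := by
    intro s t hst h; exact hV (Finset.insert_subset_insert c hst) h
  -- hypotheses for M' on E'
  have hME' : ∀ μ ∈ M', μ.1 ⊆ E' ∧ μ.2 ⊆ E' := by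
    intro μ hμ
    rw [hM', Finset.mem_image] at hμ
    obtain ⟨ν, hν, rfl⟩ := hμ
    refine ⟨?_, ?_⟩
    · intro x hx
      rw [Finset.mem_erase] at hx
      exact Finset.mem_erase.mpr ⟨hx.1, (hME ν hν).1 hx.2⟩
    · intro x hx
      have hxc : x ≠ c := fun h => hc2 ν hν (h ▸ hx)
      exact Finset.mem_erase.mpr ⟨hxc, (hME ν hν).2 hx⟩
  have hst' : ∀ μ ∈ M', ∀ ν ∈ M', (μ.1 ⊆ ν.1 ∧ ν.2 ⊆ μ.2) ∨ (ν.1 ⊆ μ.1 ∧ μ.2 ⊆ ν.2) := by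
    intro μ hμ ν hν
    rw [hM', Finset.mem_image] at hμ hν
    obtain ⟨μ₀, hμ₀, rfl⟩ := hμ
    obtain ⟨ν₀, hν₀, rfl⟩ := hν
    rcases hst μ₀ hμ₀ ν₀ hν₀ with h | h
    · exact Or.inl ⟨Finset.erase_subset_erase c h.1, h.2⟩
    · exact Or.inr ⟨Finset.erase_subset_erase c h.1, h.2⟩
  have hdj' : ∀ μ ∈ M', ∀ ν ∈ M', Disjoint μ.1 ν.2 := by
    intro μ hμ ν hν
    rw [hM', Finset.mem_image] at hμ hν
    obtain ⟨μ₀, hμ₀, rfl⟩ := hμ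
    obtain ⟨ν₀, hν₀, rfl⟩ := hν
    exact Finset.disjoint_of_subset_left (Finset.erase_subset c μ₀.1) (hdj μ₀ hμ₀ ν₀ hν₀)
  -- hypotheses for M₀ on E'
  have hM₀sub : M₀ ⊆ M := Finset.filter_subset _ _
  have hME₀ : ∀ μ ∈ M₀, μ.1 ⊆ E' ∧ μ.2 ⊆ E' := by
    intro μ hμ
    rw [hM₀, Finset.mem_filter] at hμ
    refine ⟨?_, ?_⟩
    · intro x hx
      have hxc : x ≠ c := fun h => hμ.2 (h ▸ hx)
      exact Finset.mem_erase.mpr ⟨hxc, (hME μ hμ.1).1 hx⟩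
    · intro x hx
      have hxc : x ≠ c := fun h => hc2 μ hμ.1 (h ▸ hx)
      exact Finset.mem_erase.mpr ⟨hxc, (hME μ hμ.1).2 hx⟩
  have hst₀ : ∀ μ ∈ M₀, ∀ ν ∈ M₀, (μ.1 ⊆ ν.1 ∧ ν.2 ⊆ μ.2) ∨ (ν.1 ⊆ μ.1 ∧ μ.2 ⊆ ν.2) :=
    fun μ hμ ν hν => hst μ (hM₀sub hμ) ν (hM₀sub hν)
  have hdj₀ : ∀ μ ∈ M₀, ∀ ν ∈ M₀, Disjoint μ.1 ν.2 :=
    fun μ hμ ν hν => hdj μ (hM₀sub hμ) ν (hM₀sub hν)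
  -- the two sub-problems
  set S₀ : Finset (Finset ι) := (E'.powerset).filter fun ω => 𝒱 ω ∧ ∃ μ ∈ M', Disjoint ω (μ.1 ∪ μ.2) with hS₀
  set T₀ : Finset (Finset ι) := (E'.powerset).filter fun ω => 𝒱 ω ∧ ∃ μ ∈ M', μ.1 ∪ μ.2 ⊆ ω with hT₀
  set S₁ : Finset (Finset ι) := (E'.powerset).filter fun ω => 𝒱₁ ω ∧ ∃ μ ∈ M₀, Disjoint ω (μ.1 ∪ μ.2) with hS₁
  set T₁ : Finset (Finset ι) := (E'.powerset).filter fun ω => 𝒱₁ ω ∧ ∃ μ ∈ M₀, μ.1 ∪ μ.2 ⊆ ω with hT₁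
  have IH₀ : #S₀ ≤ #T₀ := IH E' hE'card M' hME' hst' hdj' 𝒱 hV
  have IH₁ : #S₁ ≤ #T₁ := IH E' hE'card M₀ hME₀ hst₀ hdj₀ 𝒱₁ hV₁
  -- split the sources along c
  have hsplit : #S = #(S.filter fun ω => c ∉ ω) + #(S.filter fun ω => ¬ c ∉ ω) :=
    (Finset.card_filter_add_card_filter_not (s := S) (fun ω => c ∉ ω)).symm
  -- slice c ∉ ω : these sources are exactly S₀
  have hslice0 : (S.filter fun ω => c ∉ ω) ⊆ S₀ := by
    intro ω hω
    rw [Finset.mem_filter] at hω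
    obtain ⟨hωS, hcω⟩ := hω
    rw [hS, Finset.mem_filter, Finset.mem_powerset] at hωS
    obtain ⟨hωE, hVω, μ, hμ, hdisj⟩ := hωS
    rw [hS₀, Finset.mem_filter, Finset.mem_powerset]
    refine ⟨?_, hVω, (μ.1.erase c, μ.2), ?_, ?_⟩
    · intro x hx; exact Finset.mem_erase.mpr ⟨fun h => hcω (h ▸ hx), hωE hx⟩
    · rw [hM']; exact Finset.mem_image.mpr ⟨μ, hμ, rfl⟩
    · refine Finset.disjoint_of_subset_right ?_ hdisj
      exact Finset.union_subset_union (Finset.erase_subset c μ.1) le_rfl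
  -- slice c ∈ ω : after erasing c these sources lie in S₁
  have hslice1 : (S.filter fun ω => ¬ c ∉ ω) ⊆ S₁.image fun ω => insert c ω := by
    intro ω hω
    rw [Finset.mem_filter, not_not] at hω
    obtain ⟨hωS, hcω⟩ := hω
    rw [hS, Finset.mem_filter, Finset.mem_powerset] at hωS
    obtain ⟨hωE, hVω, μ, hμ, hdisj⟩ := hωS
    rw [Finset.mem_image]
    refine ⟨ω.erase c, ?_, Finset.insert_erase hcω⟩
    rw [hS₁, Finset.mem_filter, Finset.mem_powerset]
    refine ⟨Finset.erase_subset_erase c hωE, ?_, μ, ?_, ?_⟩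
    · show 𝒱 (insert c (ω.erase c)); rw [Finset.insert_erase hcω]; exact hVω
    · rw [hM₀, Finset.mem_filter]
      refine ⟨hμ, fun hcμ => ?_⟩
      exact Finset.disjoint_left.mp hdisj hcω (Finset.mem_union_left _ hcμ)
    · exact Finset.disjoint_of_subset_left (Finset.erase_subset c ω) hdisj
  have hcard1 : #(S.filter fun ω => ¬ c ∉ ω) ≤ #S₁ :=
    (Finset.card_le_card hslice1).trans Finset.card_image_le
  -- three disjoint groups of targets inside T
  set q : Finset ι → Prop := fun ω => ∃ μ ∈ M₀, μ.1 ∪ μ.2 ⊆ ω with hq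
  set G₀ : Finset (Finset ι) := T₀.filter fun ω => q ω with hG₀
  set Gp : Finset (Finset ι) := (T₀.filter fun ω => ¬ q ω).image fun ω => insert c ω with hGp
  set G₁ : Finset (Finset ι) := T₁.image fun ω => insert c ω with hG₁
  have hinj : ∀ A : Finset (Finset ι), A ⊆ E'.powerset → Set.InjOn (fun ω : Finset ι => insert c ω) (A : Set (Finset ι)) := by
    intro A hA ω₁ h₁ ω₂ h₂ heq
    have hc1 : c ∉ ω₁ := fun h => by
      have := Finset.mem_powerset.mp (hA h₁) h; rw [hE', Finset.mem_erase] at this; exact this.1 rfl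
    have hc2' : c ∉ ω₂ := fun h => by
      have := Finset.mem_powerset.mp (hA h₂) h; rw [hE', Finset.mem_erase] at this; exact this.1 rfl
    have := congrArg (fun s => Finset.erase s c) heq
    simpa [Finset.erase_insert hc1, Finset.erase_insert hc2'] using this
  have hT₀sub : T₀ ⊆ E'.powerset := Finset.filter_subset _ _
  have hT₁sub : T₁ ⊆ E'.powerset := Finset.filter_subset _ _
  have hGp_card : #Gp = #(T₀.filter fun ω => ¬ q ω) := by
    rw [hGp]; exact Finset.card_image_of_injOn (hinj _ ((Finset.filter_subset _ _).trans hT₀sub))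
  have hG₁_card : #G₁ = #T₁ := by
    rw [hG₁]; exact Finset.card_image_of_injOn (hinj _ hT₁sub)
  have hT₀split : #T₀ = #G₀ + #(T₀.filter fun ω => ¬ q ω) := by
    rw [hG₀]; exact (Finset.card_filter_add_card_filter_not (s := T₀) q).symm
  -- the groups lie in T
  have hE'E : E' ⊆ E := Finset.erase_subset c E
  have hG₀T : G₀ ⊆ T := by
    intro ω hω
    rw [hG₀, Finset.mem_filter, hT₀, Finset.mem_filter, Finset.mem_powerset] at hω
    obtain ⟨⟨hωE', hVω, -⟩, μ, hμ, hsub⟩ := hω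
    rw [hT, Finset.mem_filter, Finset.mem_powerset]
    exact ⟨hωE'.trans hE'E, hVω, μ, hM₀sub hμ, hsub⟩
  have hGpT : Gp ⊆ T := by
    intro ω hω
    rw [hGp, Finset.mem_image] at hω
    obtain ⟨ω', hω', rfl⟩ := hω
    rw [Finset.mem_filter, hT₀, Finset.mem_filter, Finset.mem_powerset] at hω'
    obtain ⟨⟨hωE', hVω, μ, hμ, hsub⟩, -⟩ := hω'
    rw [hM', Finset.mem_image] at hμ
    obtain ⟨ν, hν, rfl⟩ := hμ
    rw [hT, Finset.mem_filter, Finset.mem_powerset]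
    refine ⟨Finset.insert_subset hcE (hωE'.trans hE'E), hV (Finset.subset_insert c ω') hVω, ν, hν, ?_⟩
    intro x hx
    rw [Finset.mem_union] at hx
    rw [Finset.mem_insert]
    by_cases hxc : x = c
    · exact Or.inl hxc
    · right
      apply hsub
      rcases hx with hx | hx
      · exact Finset.mem_union_left _ (Finset.mem_erase.mpr ⟨hxc, hx⟩)
      · exact Finset.mem_union_right _ hx
  have hG₁T : G₁ ⊆ T := by
    intro ω hω
    rw [hG₁, Finset.mem_image] at hω
    obtain ⟨ω', hω', rfl⟩ := hω
    rw [hT₁, Finset.mem_filter, Finset.mem_powerset] at hω'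
    obtain ⟨hωE', hVω, μ, hμ, hsub⟩ := hω'
    rw [hT, Finset.mem_filter, Finset.mem_powerset]
    exact ⟨Finset.insert_subset hcE (hωE'.trans hE'E), hVω, μ, hM₀sub hμ, hsub.trans (Finset.subset_insert c ω')⟩
  -- the groups are pairwise disjoint
  have hcG₀ : ∀ ω ∈ G₀, c ∉ ω := by
    intro ω hω hc
    rw [hG₀, Finset.mem_filter] at hω
    have := Finset.mem_powerset.mp (hT₀sub hω.1) hc
    rw [hE', Finset.mem_erase] at this; exact this.1 rfl
  have hcGp : ∀ ω ∈ Gp, c ∈ ω ∧ ¬ q ω := by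
    intro ω hω
    rw [hGp, Finset.mem_image] at hω
    obtain ⟨ω', hω', rfl⟩ := hω
    rw [Finset.mem_filter] at hω'
    refine ⟨Finset.mem_insert_self c ω', fun hqω => hω'.2 ?_⟩
    obtain ⟨μ, hμ, hsub⟩ := hqω
    refine ⟨μ, hμ, fun x hx => ?_⟩
    have hxins := hsub hx
    rw [Finset.mem_insert] at hxins
    rcases hxins with hxc | hxω'
    · exfalso
      rw [hM₀, Finset.mem_filter] at hμ
      rw [Finset.mem_union] at hx
      rcases hx with hx | hx
      · exact hμ.2 (hxc ▸ hx)
      · exact hc2 μ hμ.1 (hxc ▸ hx)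
    · exact hxω'
  have hcG₁ : ∀ ω ∈ G₁, c ∈ ω ∧ q ω := by
    intro ω hω
    rw [hG₁, Finset.mem_image] at hω
    obtain ⟨ω', hω', rfl⟩ := hω
    rw [hT₁, Finset.mem_filter] at hω'
    obtain ⟨-, -, μ, hμ, hsub⟩ := hω'
    exact ⟨Finset.mem_insert_self c ω', μ, hμ, hsub.trans (Finset.subset_insert c ω')⟩
  have hd01 : Disjoint G₀ Gp := by
    rw [Finset.disjoint_left]; intro ω h₀ hp; exact hcG₀ ω h₀ (hcGp ω hp).1
  have hd02 : Disjoint G₀ G₁ := by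
    rw [Finset.disjoint_left]; intro ω h₀ h₁; exact hcG₀ ω h₀ (hcG₁ ω h₁).1
  have hdp1 : Disjoint Gp G₁ := by
    rw [Finset.disjoint_left]; intro ω hp h₁; exact (hcGp ω hp).2 (hcG₁ ω h₁).2
  have hunion : #(G₀ ∪ Gp ∪ G₁) = #G₀ + #Gp + #G₁ := by
    rw [Finset.card_union_of_disjoint, Finset.card_union_of_disjoint hd01]
    rw [Finset.disjoint_union_left]; exact ⟨hd02, hdp1⟩
  have hsubT : G₀ ∪ Gp ∪ G₁ ⊆ T :=
    Finset.union_subset (Finset.union_subset hG₀T hGpT) hG₁T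
  -- assemble
  calc #S = #(S.filter fun ω => c ∉ ω) + #(S.filter fun ω => ¬ c ∉ ω) := hsplit
    _ ≤ #S₀ + #S₁ := Nat.add_le_add (Finset.card_le_card hslice0) hcard1
    _ ≤ #T₀ + #T₁ := Nat.add_le_add IH₀ IH₁
    _ = #G₀ + #Gp + #G₁ := by rw [hT₀split, hGp_card, hG₁_card]
    _ = #(G₀ ∪ Gp ∪ G₁) := hunion.symm
    _ ≤ #T := Finset.card_le_card hsubT

open Classical in
/-- **Staircase lemma.**  For a staircase family `M` of pairs of subsets of `E` (first components and second components oppositely nested, every first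
component disjoint from every second component) and an up-closed event `𝒱` on `2^E`: the `𝒱`-colourings meeting no edge of some `a ∪ b`, `(a, b) ∈ M`
(union of bottom faces) are at most as many as the `𝒱`-colourings containing some `a ∪ b` (union of top faces).  Proof by induction on `#E` with
`card_staircase_step`, applied to `M` or to the swapped family (one coordinate of `E` always avoids all second or all first components).
[cite: KozmaNitzan2024, Questions 8–9 (§5.5 p. 36) (context); Harris 1960] -/
theorem card_staircase_bottom_le_top [DecidableEq ι] (E : Finset ι) (M : Finset (Finset ι × Finset ι))
    (hME : ∀ μ ∈ M, μ.1 ⊆ E ∧ μ.2 ⊆ E)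
    (hst : ∀ μ ∈ M, ∀ ν ∈ M, (μ.1 ⊆ ν.1 ∧ ν.2 ⊆ μ.2) ∨ (ν.1 ⊆ μ.1 ∧ μ.2 ⊆ ν.2))
    (hdj : ∀ μ ∈ M, ∀ ν ∈ M, Disjoint μ.1 ν.2)
    (𝒱 : Finset ι → Prop) (hV : ∀ ⦃s t : Finset ι⦄, s ⊆ t → 𝒱 s → 𝒱 t) :
    #((E.powerset).filter fun ω => 𝒱 ω ∧ ∃ μ ∈ M, Disjoint ω (μ.1 ∪ μ.2)) ≤
      #((E.powerset).filter fun ω => 𝒱 ω ∧ ∃ μ ∈ M, μ.1 ∪ μ.2 ⊆ ω) := by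
  -- strong induction on the size of the ground set
  suffices h : ∀ n : ℕ, ∀ E : Finset ι, E.card ≤ n → ∀ M : Finset (Finset ι × Finset ι),
      (∀ μ ∈ M, μ.1 ⊆ E ∧ μ.2 ⊆ E) →
      (∀ μ ∈ M, ∀ ν ∈ M, (μ.1 ⊆ ν.1 ∧ ν.2 ⊆ μ.2) ∨ (ν.1 ⊆ μ.1 ∧ μ.2 ⊆ ν.2)) →
      (∀ μ ∈ M, ∀ ν ∈ M, Disjoint μ.1 ν.2) →
      ∀ 𝒱 : Finset ι → Prop, (∀ ⦃s t : Finset ι⦄, s ⊆ t → 𝒱 s → 𝒱 t) →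
        #((E.powerset).filter fun ω => 𝒱 ω ∧ ∃ μ ∈ M, Disjoint ω (μ.1 ∪ μ.2)) ≤
          #((E.powerset).filter fun ω => 𝒱 ω ∧ ∃ μ ∈ M, μ.1 ∪ μ.2 ⊆ ω) from
    h E.card E le_rfl M hME hst hdj 𝒱 hV
  intro n
  induction n with
  | zero =>
    intro E hE M hME hst hdj 𝒱 hV
    have hE0 : E = ∅ := Finset.card_eq_zero.mp (Nat.le_zero.mp hE)
    subst hE0
    apply Finset.card_le_card
    intro ω hω
    rw [Finset.mem_filter, Finset.mem_powerset] at hω ⊢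
    obtain ⟨hωE, hVω, μ, hμ, -⟩ := hω
    refine ⟨hωE, hVω, μ, hμ, ?_⟩
    have h1 : μ.1 = ∅ := Finset.subset_empty.mp (hME μ hμ).1
    have h2 : μ.2 = ∅ := Finset.subset_empty.mp (hME μ hμ).2
    rw [h1, h2, Finset.empty_union]; exact Finset.empty_subset ω
  | succ n ihn =>
    intro E hE M hME hst hdj 𝒱 hV
    by_cases hEn : E.card ≤ n
    · exact ihn E hEn M hME hst hdj 𝒱 hV
    have hEpos : 0 < E.card := by omega
    obtain ⟨c, hcE⟩ := Finset.card_pos.mp hEpos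
    have IH : ∀ E' : Finset ι, E'.card < E.card → ∀ M' : Finset (Finset ι × Finset ι),
        (∀ μ ∈ M', μ.1 ⊆ E' ∧ μ.2 ⊆ E') →
        (∀ μ ∈ M', ∀ ν ∈ M', (μ.1 ⊆ ν.1 ∧ ν.2 ⊆ μ.2) ∨ (ν.1 ⊆ μ.1 ∧ μ.2 ⊆ ν.2)) →
        (∀ μ ∈ M', ∀ ν ∈ M', Disjoint μ.1 ν.2) →
        ∀ 𝒱' : Finset ι → Prop, (∀ ⦃s t : Finset ι⦄, s ⊆ t → 𝒱' s → 𝒱' t) →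
          #((E'.powerset).filter fun ω => 𝒱' ω ∧ ∃ μ ∈ M', Disjoint ω (μ.1 ∪ μ.2)) ≤
            #((E'.powerset).filter fun ω => 𝒱' ω ∧ ∃ μ ∈ M', μ.1 ∪ μ.2 ⊆ ω) := by
      intro E' hE' M' hME' hst' hdj' 𝒱' hV'
      exact ihn E' (by omega) M' hME' hst' hdj' 𝒱' hV'
    -- c lies in no second component, or in no first component
    by_cases hc2 : ∃ ν ∈ M, c ∈ ν.2
    swap
    · exact card_staircase_step E IH M hME hst hdj 𝒱 hV c hcE (fun μ hμ h => hc2 ⟨μ, hμ, h⟩)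
    · obtain ⟨ν, hν, hcν⟩ := hc2
      have hc1 : ∀ μ ∈ M, c ∉ μ.1 := by
        intro μ hμ hcμ
        exact Finset.disjoint_left.mp (hdj μ hμ ν hν) hcμ hcν
      -- apply the step to the swapped family
      set Ms : Finset (Finset ι × Finset ι) := M.image Prod.swap with hMs
      have hMEs : ∀ μ ∈ Ms, μ.1 ⊆ E ∧ μ.2 ⊆ E := by
        intro μ hμ; rw [hMs, Finset.mem_image] at hμ; obtain ⟨μ₀, hμ₀, rfl⟩ := hμ
        exact ⟨(hME μ₀ hμ₀).2, (hME μ₀ hμ₀).1⟩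
      have hsts : ∀ μ ∈ Ms, ∀ ν ∈ Ms, (μ.1 ⊆ ν.1 ∧ ν.2 ⊆ μ.2) ∨ (ν.1 ⊆ μ.1 ∧ μ.2 ⊆ ν.2) := by
        intro μ hμ ν' hν'
        rw [hMs, Finset.mem_image] at hμ hν'
        obtain ⟨μ₀, hμ₀, rfl⟩ := hμ; obtain ⟨ν₀, hν₀, rfl⟩ := hν'
        rcases hst μ₀ hμ₀ ν₀ hν₀ with h | h
        · exact Or.inr ⟨h.2, h.1⟩
        · exact Or.inl ⟨h.2, h.1⟩
      have hdjs : ∀ μ ∈ Ms, ∀ ν ∈ Ms, Disjoint μ.1 ν.2 := by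
        intro μ hμ ν' hν'
        rw [hMs, Finset.mem_image] at hμ hν'
        obtain ⟨μ₀, hμ₀, rfl⟩ := hμ; obtain ⟨ν₀, hν₀, rfl⟩ := hν'
        exact (hdj ν₀ hν₀ μ₀ hμ₀).symm
      have hc2s : ∀ μ ∈ Ms, c ∉ μ.2 := by
        intro μ hμ; rw [hMs, Finset.mem_image] at hμ; obtain ⟨μ₀, hμ₀, rfl⟩ := hμ
        exact hc1 μ₀ hμ₀
      have key := card_staircase_step E IH Ms hMEs hsts hdjs 𝒱 hV c hcE hc2s
      -- the source and target sets of the swapped family are the original ones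
      have hsrc : ((E.powerset).filter fun ω => 𝒱 ω ∧ ∃ μ ∈ Ms, Disjoint ω (μ.1 ∪ μ.2)) =
          ((E.powerset).filter fun ω => 𝒱 ω ∧ ∃ μ ∈ M, Disjoint ω (μ.1 ∪ μ.2)) := by
        apply Finset.filter_congr
        intro ω _
        constructor
        · rintro ⟨hVω, μ, hμ, hd⟩
          rw [hMs, Finset.mem_image] at hμ; obtain ⟨μ₀, hμ₀, rfl⟩ := hμ
          exact ⟨hVω, μ₀, hμ₀, by rwa [Finset.union_comm] at hd⟩
        · rintro ⟨hVω, μ, hμ, hd⟩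
          refine ⟨hVω, μ.swap, ?_, by simpa [Finset.union_comm] using hd⟩
          rw [hMs]; exact Finset.mem_image.mpr ⟨μ, hμ, rfl⟩
      have htgt : ((E.powerset).filter fun ω => 𝒱 ω ∧ ∃ μ ∈ Ms, μ.1 ∪ μ.2 ⊆ ω) =
          ((E.powerset).filter fun ω => 𝒱 ω ∧ ∃ μ ∈ M, μ.1 ∪ μ.2 ⊆ ω) := by
        apply Finset.filter_congr
        intro ω _
        constructor
        · rintro ⟨hVω, μ, hμ, hd⟩
          rw [hMs, Finset.mem_image] at hμ; obtain ⟨μ₀, hμ₀, rfl⟩ := hμ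
          exact ⟨hVω, μ₀, hμ₀, by rwa [Finset.union_comm] at hd⟩
        · rintro ⟨hVω, μ, hμ, hd⟩
          refine ⟨hVω, μ.swap, ?_, by simpa [Finset.union_comm] using hd⟩
          rw [hMs]; exact Finset.mem_image.mpr ⟨μ, hμ, rfl⟩
      rw [hsrc, htgt] at key
      exact key

end Coefficientwise

end Summit.CriticalPhenomena.PercolationContinuityZ3.Theorems
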